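import Mathlib
import HarnessLib
import HarnessLib.Audit
import Summits.Parity.Statement
import Literature.Barriers.Parity.SiegelZeroDichotomy
import Literature.NumberTheory.Sieve.HardyLittlewood
import Literature.NumberTheory.Sieve.PolymathBoundedGaps

/-!
Route: GhostBoundaryCarving

DORMANT since 2026-09-04T15:41:08Z (reconciler: no traction for 5 d (last activity statement-checked at 2026-08-30T14:19:05Z); parked, not closed — `ledger route dormant route-Parity-GhostBoundaryCarving --off` to reactivate) — unstaffed, not closed; items shared with open routes are served there. `ledger route dormant <id> --off` reactivates.

# Route GhostBoundaryCarving — GHL ⟸ the record's Siegel/upper/uniform leaves ∧ DHL[3,2] ∧ the pair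
lift DHL[3,2] → fixed-pattern lower bound

decomp-parity (D-0178/D-0179) lens-6 g4 node «GhostBoundaryCarving» (RESIDUAL mode, critic CLEARED
HOME/STATUS.md l.200, CRITIC-LEDGER row 44;
filing (B) standalone per writer l.195): an ALTERNATIVE DECOMPOSITION of the record route
route-Parity-SiegelSpectrumSplit beneath its fixed-pattern
lower leaf FL = stmt-Parity-26863. It suffices to show X = Q ∧ FixedUpper ∧ UniformUpperGivenFixed ∧
TwoOfThree ∧ PairLift ∧ UniformLowerGivenFixed,
where Q (25148), FixedUpper (26852), UniformUpperGivenFixed (26853), UniformLowerGivenFixed (26864)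
are the record's items VERBATIM (shared by
signature), TwoOfThree := DHL[3,2] (every admissible triple of shifts has infinitely many translates
containing at least two primes — the minimal
GHOST-FREE cell of the tree's parity-ghost LP,
Literature.Barriers.Parity.hasThresholdGhost_iff_add_two_le) and PairLift := TwoOfThree → FixedLower
(the declared residual: all parity content). Kernel
(HOME/decomp-parity-lens-6/g4/GhostBoundaryCarving.lean, rc 0): FixedLower ↔ TwoOfThree ∧ PairLift
(fixedLower_iff, via the NEW leaf-level necessity theorem weakDHL_of_fixedLower : FixedLower → ∀ k,
DHL[k,k]); closes with 6/6 binders through the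
born SiegelSpectrumSplit.closes and the CLOSED glue theorems; node_iff modulo the record's GHL ⟹ Q.
Lean: `(∃ η₀ : ℝ, ∃ q₀ : ℕ, ∀ (q : ℕ) [NeZero q] (χ : DirichletCharacter ℂ q) (η : ℝ), q₀ ≤ q →
Literature.Barriers.Parity.IsSiegelZero χ η → η < η₀) ∧ (∀ (d t : ℕ), 1 ≤ d → 1 ≤ t → ∀ Ψ : Fin t →
Literature.NumberTheory.Sieve.AffLinForm d, Literature.NumberTheory.Sieve.IsNondegenerateSystem Ψ →
∀ ε : ℝ, 0 < ε → ∃ N₀ : ℕ, ∀ N : ℕ, N₀ ≤ N → ∀ K : Set (Fin d → ℝ), Convex ℝ K → K ⊆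
Literature.NumberTheory.Sieve.realBox d N → Literature.NumberTheory.Sieve.vonMangoldtSum Ψ K N -
Literature.NumberTheory.Sieve.archFactor Ψ K * Literature.NumberTheory.Sieve.singularProduct Ψ ≤ ε *
(N : ℝ) ^ d) ∧ ((∃ η₀ : ℝ, ∃ q₀ : ℕ, ∀ (q : ℕ) [NeZero q] (χ : DirichletCharacter ℂ q) (η : ℝ), q₀ ≤
q → Literature.Barriers.Parity.IsSiegelZero χ η → η < η₀) → (∀ (d t : ℕ), 1 ≤ d → 1 ≤ t → ∀ Ψ : Fin
t → Literature.NumberTheory.Sieve.AffLinForm d, Literature.NumberTheory.Sieve.IsNondegenerateSystem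
Ψ → ∀ ε : ℝ, 0 < ε → ∃ N₀ : ℕ, ∀ N : ℕ, N₀ ≤ N → ∀ K : Set (Fin d → ℝ), Convex ℝ K → K ⊆
Literature.NumberTheory.Sieve.realBox d N → Literature.NumberTheory.Sieve.vonMangoldtSum Ψ K N -
Literature.NumberTheory.Sieve.archFactor Ψ K * Literature.NumberTheory.Sieve.singularProduct Ψ ≤ ε *
(N : ℝ) ^ d) → ∀ (d t L : ℕ), 1 ≤ d → 1 ≤ t → ∀ ε : ℝ, 0 < ε → ∃ N₀ : ℕ, ∀ N : ℕ, N₀ ≤ N → ∀ Ψ : Fin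
t → Literature.NumberTheory.Sieve.AffLinForm d, Literature.NumberTheory.Sieve.IsNondegenerateSystem
Ψ → Literature.NumberTheory.Sieve.affLinSize Ψ N ≤ L → ∀ K : Set (Fin d → ℝ), Convex ℝ K → K ⊆
Literature.NumberTheory.Sieve.realBox d N → Literature.NumberTheory.Sieve.vonMangoldtSum Ψ K N -
Literature.NumberTheory.Sieve.archFactor Ψ K * Literature.NumberTheory.Sieve.singularProduct Ψ ≤ ε *
(N : ℝ) ^ d) ∧ (Literature.NumberTheory.Sieve.WeakDicksonHardyLittlewood 3 2) ∧
(Literature.NumberTheory.Sieve.WeakDicksonHardyLittlewood 3 2 → ∀ (d t : ℕ), 1 ≤ d → 1 ≤ t → ∀ Ψ :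
Fin t → Literature.NumberTheory.Sieve.AffLinForm d,
Literature.NumberTheory.Sieve.IsNondegenerateSystem Ψ → ∀ ε : ℝ, 0 < ε → ∃ N₀ : ℕ, ∀ N : ℕ, N₀ ≤ N →
∀ K : Set (Fin d → ℝ), Convex ℝ K → K ⊆ Literature.NumberTheory.Sieve.realBox d N →
Literature.NumberTheory.Sieve.archFactor Ψ K * Literature.NumberTheory.Sieve.singularProduct Ψ -
Literature.NumberTheory.Sieve.vonMangoldtSum Ψ K N ≤ ε * (N : ℝ) ^ d) ∧ ((∃ η₀ : ℝ, ∃ q₀ : ℕ, ∀ (q :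
ℕ) [NeZero q] (χ : DirichletCharacter ℂ q) (η : ℝ), q₀ ≤ q → Literature.Barriers.Parity.IsSiegelZero
χ η → η < η₀) → (∀ (d t : ℕ), 1 ≤ d → 1 ≤ t → ∀ Ψ : Fin t → Literature.NumberTheory.Sieve.AffLinForm
d, Literature.NumberTheory.Sieve.IsNondegenerateSystem Ψ → ∀ ε : ℝ, 0 < ε → ∃ N₀ : ℕ, ∀ N : ℕ, N₀ ≤
N → ∀ K : Set (Fin d → ℝ), Convex ℝ K → K ⊆ Literature.NumberTheory.Sieve.realBox d N →
Literature.NumberTheory.Sieve.archFactor Ψ K * Literature.NumberTheory.Sieve.singularProduct Ψ -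
Literature.NumberTheory.Sieve.vonMangoldtSum Ψ K N ≤ ε * (N : ℝ) ^ d) → ∀ (d t L : ℕ), 1 ≤ d → 1 ≤ t
→ ∀ ε : ℝ, 0 < ε → ∃ N₀ : ℕ, ∀ N : ℕ, N₀ ≤ N → ∀ Ψ : Fin t →
Literature.NumberTheory.Sieve.AffLinForm d, Literature.NumberTheory.Sieve.IsNondegenerateSystem Ψ →
Literature.NumberTheory.Sieve.affLinSize Ψ N ≤ L → ∀ K : Set (Fin d → ℝ), Convex ℝ K → K ⊆
Literature.NumberTheory.Sieve.realBox d N → Literature.NumberTheory.Sieve.archFactor Ψ K *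
Literature.NumberTheory.Sieve.singularProduct Ψ - Literature.NumberTheory.Sieve.vonMangoldtSum Ψ K N
≤ ε * (N : ℝ) ^ d)`

## Assembly
Pure logic plus |a − b| ≤ c ⟺ (a − b ≤ c ∧ b − a ≤ c): hUU hQ hFU is the uniform upper half, hUL hQ
(hR hA) the uniform lower half (PairLift consumes
TwoOfThree and yields FixedLower), and the two halves with N₀ := max give GHL (`closes` in
glue.lean, 6/6 binders consumed). Exactness in the cell
file: fixedLower_iff (FixedLower ↔ TwoOfThree ∧ PairLift, kernel) and node_iff (GHL ↔ X modulo the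
record's necessity of Q).

Rationale: WHY THIS LINE. The tree's parity-ghost linear programme
(Literature.Barriers.Parity.TargetGraphParity, hasThresholdGhost_iff_add_two_le: the target «≥ m
primes among
k shifts» is ghosted iff k + 2 ≤ 2m) is the sharp form of Selberg's parity obstruction for threshold
targets; Polymath8b2014 (Thm 1.6-type argument,
[corpus:book:broughannd-bounded-gaps-between-primes p.230 (4)]) records that H₁ ≤ 6, i.e. the (3,2)
cell, «was the best possible result using any type of
sieve», and proves GEH ⟹ DHL[3,2] (Thm 3.2(xii); tree fact weakDHL_three_two_of_GEH, DISCHARGED by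
weakDHL_three_two_of_GEH_holds). The record
leaf FL (GT Conj. 1.2 lower half for one fixed system) lives entirely on ghosted cells (k,k);
cutting it AT the LP boundary makes the strongest
ghost-free consequence, DHL[3,2], a load-bearing binder with a theorem-grade separation (decided in
the GEH model where FL is not), and isolates the
parity content in one explicit residual implication. Imported: the GPY–Maynard–Tao–Polymath
multidimensional sieve (Maynard2015SmallGaps,
Polymath8b2014, tree MaynardTao / PolymathBoundedGaps* incl. the kernel theorem DHL[50,2]),
Gallagher's shift-system dictionary
(tree PrimeGapLimitPointsOfGHL) and Chebyshev's ψ − θ bound (Mathlib) for the necessity theorem.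
Versus prior routes: the record and every cell
route keep bounded-gaps statements as RUNGS beneath costume leaves (census WK9); the retired
TargetGraphParity route (closed not-a-thesis) reached
only an analogue (GraphDHL); here the piece is typed BY NAME as the tree's DHL[3,2], is
kernel-necessary from the leaf, from GHL and from BH, and the
glue reaches the Statement.

RANKED CRUXES. #2 TwoOfThree (crux) — DHL[3,2]: for every admissible 3-tuple H ⊂ ℤ there are
infinitely many n with at least two of n + h (h ∈ H) prime (Polymath8b Thm 3.2(xii) under GEH;
unconditional is OPEN — zone II: needs distribution beyond level ½ for ε-enlarged-simplex weights;
NOT for provers: GEH-hard, staffable work = landing the kernel necessity theorem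
weakDHL_of_fixedLower under Theorems/ and zone-I instrument rungs DHL[k,2], 24 ≤ k ≤ 49, via MPZ +
certified numerics, zero distance credit; cross-refs: census routes PolymathEpsThreeCeiling,
MaynardProductExact; retired TargetGraphParity). [difficulty: open-problem] (why it might fail:
Kernel-implied by GHL and by BH, so false only with Parity; live risk = unprovable by present means:
no Maynard criterion reaches (3,2) at any level θ ≤ 1 (not_maynardCriterion_pairs_of_le_one) and
level ½ blocks k ≤ 23 even with the ε-trick.) [Polymath8b2014, Maynard2015SmallGaps,
book:broughannd-bounded-gaps-between-primes, arXiv:1409.8361,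
Literature.Barriers.Parity.MaynardFunctionalCeiling, Literature.Barriers.Parity.TargetGraphParity]
#3 PairLift (crux) — DHL[3,2] → FixedLower (the record leaf stmt-Parity-26863, text verbatim): from
«two primes among three shifts infinitely often» to the one-sided Hardy–Littlewood lower bound
archFactor·singularProduct − vonMangoldtSum ≤ εN^d for every fixed non-degenerate system — DECLARED
RESIDUAL (all parity content; zero credit; never staffed before TwoOfThree). [deps: TwoOfThree]
[difficulty: open-problem] (why it might fail: Kernel-implied by GHL; as an implication it must
manufacture prime PAIRS with the HL constant from a ≥2-of-3 existence statement — head-on against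
PrimePairParity / SelbergParity / FordMaynard (bounded gaps name no pattern).) [Polymath8b2014,
FordMaynard2024PrimeSieves, Selberg1949, Bombieri1976, Literature.Barriers.Parity.PrimePairParity,
Literature.Barriers.Parity.SelbergParity]
#4 UniformLowerGivenFixed (crux) — the record's item stmt-Parity-26864 verbatim (Q → FixedLower →
the uniform lower half of GHL); shared by signature, filing fields = the record's. [difficulty:
open-problem] (why it might fail: It contains binary Goldbach with the Hardy–Littlewood main term
for every large even N, given Q and the tuples: no method controls an individual shift h ≍ N;
almost-all-h results (MRT 2019, window N^(8/33)) are the ceiling.) [GreenTao2010,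
HardyLittlewood1923, MatomakiRadziwillTao2019, MatomakiMerikoski2023,
Literature.Barriers.Parity.CircleMethodBinary]
#5 UniformUpperGivenFixed (crux) — the record's item stmt-Parity-26853 verbatim (Q → FixedUpper →
the uniform upper half of GHL); shared by signature, filing fields = the record's. [difficulty:
open-problem] (why it might fail: It is the uniform-in-shift (binary Goldbach-type) upper bound with
factor 1+ε given Q and all tuples: pointwise-in-h control beyond windows N^(8/33) (MRT 2019) is
open; the circle method misses binary minor arcs by log x.) [GreenTao2010, MatomakiRadziwillTao2019,
MatomakiMerikoski2023, Literature.Barriers.Parity.TrueComplexityBinary,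
Literature.Barriers.Parity.CircleMethodBinary]
#6 BoundedSiegelZeroQuality (crux) — the record's Siegel crux stmt-Parity-25148 verbatim
(exceptional zeros have bounded quality η); shared by signature, filing fields = the record's.
[difficulty: open-problem] (why it might fail: it is the Landau–Siegel problem: no unconditional
bound on η is known (Siegel's theorem is ineffective); a genuine open problem, not a lemma.)
[HeathBrown1983PrimeTwins, MatomakiMerikoski2023, TaoTeravainen2021]
#7 FixedUpper (crux) — the record's item stmt-Parity-26852 verbatim (upper half of GT Conj. 1.2 for
every fixed non-degenerate system); shared by signature, filing fields = the record's. [difficulty: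
open-problem] (why it might fail: As a target it contains the upper prime k-tuples bound with
constant 1+ε for every fixed tuple: Type-I sieves stop at factor 2 (Selberg parity,
LinearSieveOptimality); record 3.2996 for twins; open even under GRH.) [GreenTao2010,
HardyLittlewood1923, Selberg1949, Literature.Barriers.Parity.SelbergParity,
Literature.Barriers.Parity.LinearSieveOptimality]

TWO-LAYER PLAN. None at open. TwoOfThree is a literal terminal notch (k₀ = 3) and is never split by
k (rungs DHL[k,2], 3 < k ≤ 49, are INSTRUMENTS filed, if at all,
as census/kit items with zero distance credit; DHL[k,2] for k ≥ 50 is the tree theorem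
weakDHL_fifty_two). PairLift is a residual and is never split.
If TwoOfThree lands, PairLift ≡ FixedLower (costume) and the lower side of this route is superseded
by the record (declared).

KILL CRITERIA. A refutation of TwoOfThree refutes FixedLower, GHL and BH (kernel necessity ×3):
route, sub-problem and summit close refuted together. A proof that
FixedLower does NOT imply DHL[3,2] is impossible (kernel theorem). A landed theorem «DHL[3,2]
unconditionally» closes TwoOfThree and collapses the
route onto the record (PairLift becomes FL: superseded, declared). A tribunal finding that
TwoOfThree is a RUNG not a piece (WK9) retires the route to
the census ladder; the kernel theorem weakDHL_of_fixedLower survives as a support landing on 26863.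

NOT DECOMPOSED YET. TwoOfThree is not decomposed into «GEH-type distribution» ∧ «GEH → DHL[3,2]» at
open (the second is a tree theorem, the first is EH-class and would be
the whole crux: a one-real-piece split). The ghost-free antichain DHL[2m−1, m], m ≥ 3, is NOT filed
(MaynardFunctionalCeiling blocks it even under GEH;
only m = 2 has a conditional proof). No (k,m) cell with k + 2 ≤ 2m is filed (those are FixedLower's
own ghosted cells: transferred, not carved).

CHEAPEST FALSIFIER. (i) Theorem test (T8): is DHL[3,2] already a theorem? No — unconditional record
is DHL[50,2] (Polymath8b Thm 3.2(i), tree weakDHL_fifty_two); DHL[3,2]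
is known only under GEH (Thm 3.2(xii)); lean search 'WeakDicksonHardyLittlewood 3 2' finds only the
GEH fact. (ii) Rung test (WK9): is the piece
just a rung? The critic ruled (row 44): leaf-level necessity theorem + LP-boundary placement make it
the ghost-free FACTOR of FL. (iii) Vacuity:
admissible 3-tuples exist ({0,2,6}), DHL[3,2] is not provable by a trivial witness (needs two
simultaneous primes i.o. = bounded gaps ≤ 6 for that
tuple); PairLift is not vacuous (TwoOfThree is consistent, implied by GHL). (iv) C → S probes:
DHL[3,2] ⇏ GHL cheaply (BC2/BC7 P5 batteries fail).

NUMBERS. Ghost boundary: HasThresholdGhost k m ↔ k + 2 ≤ 2m; pairs column ghost-free iff k ≥ 3.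
Unconditional DHL[k,2]: k₀ = 3.5·10^6 (Zhang 2014) → 105
(Maynard2015SmallGaps) → 102 (Polymath, plain Maynard sieve) → 50 (Polymath8b Thm 3.2(i), ε-trick,
M_(50,1/25) > 4; tree kernel theorem) ;
H₁ ≤ 246 with MPZ. Conditional: EH ⟹ DHL[5,2] (maynardCriterion_five, H₁ ≤ 12); GEH ⟹ DHL[3,2] (H₁ ≤
6). Walls: ¬MaynardCriterion θ 3 1 for all
θ ≤ 1; ¬MaynardCriterion θ k 1 for k ≤ 50, θ ≤ ½; ¬PolymathCriterion (ε-trick) for k ≤ 23 at θ ≤ ½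
(tree). Zone I (attackable instruments):
24 ≤ k ≤ 49 via MPZ[ϖ,δ] (Polymath8a2014) + Thm 3.13-type numerics.

DEFINITION REQUESTS. None: every item is stated over existing declarations
(Literature.NumberTheory.Sieve.{WeakDicksonHardyLittlewood, IsAdmissibleTuple, AffLinForm,
IsNondegenerateSystem, affLinSize, realBox, vonMangoldtSum, archFactor, singularProduct},
Literature.Barriers.Parity.IsSiegelZero, DirichletCharacter).

Novelty: Searches (2026-08-30): lean search 'WeakDicksonHardyLittlewood 3 2|weakDHL_three_two|TwoOfThree'
(tree: only the GEH fact PolymathGEH.weakDHL_three_two_of_GEH and GraphDHL/TargetGraphParity barrier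
files); the cell census (COSTUME-CENSUS-v4 WK9) and TREE v4.8 (no route cuts FL by threshold); lit
search --hybrid "parity problem sieve DHL[3,2] limit H1 6 generalized Elliott-Halberstam" (corpus:
cojocaru2005 p.113, friedlandernd p.19, greaves1997 p.117 — generic parity expositions); lit galaxy
search "DHL[3,2]|H_1 ≤ 6|parity obstruction" --star all ([galaxy:panama:262611480346637] =
[corpus:book:broughannd-bounded-gaps-between-primes] p.230 items (2),(4);
[galaxy:pdf:-4779781982134597260] arXiv:1409.8361 Polymath retrospective).
Nearest prior art found: Polymath8b2014 Thm 3.2(xii)/Thm 1.6-type parity limit (DHL[3,2] under GEH;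
H₁ ≤ 6 optimal for sieves) and the tree's TargetGraphParity LP (stmt-Parity-4349 lineage; retired
route TargetGraphParity, closed not-a-thesis 2026-08-15, cruxes PentagonGEH/GraphDHL reached an
analogue only); on the hub: SiegelSpectrumSplit G1.2 (FL bare), ConstellationCubes (lens-4,
transference axis), AbelianShadowSplit (lens-2, AP shadow).
Delta: the first decomposition that cuts the fixed-pattern Hardy–Littlewood lower bound exactly at
the parity-ghost LP boundary — the minimal ghost-free cell DHL[3,2] as a load-bearing,
kernel-necessary binder (new tree-level theorem FL ⟹ DHL[k,k] ∀ k via the shift-system dictionary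
and Chebyshev) with a discharged-t  [refs: 1409.8361, book:broughannd-bounded-gaps-between-primes]

Barriers (technique_class: decomposition, multidimensional-sieve, parity-ghost-boundary): - technique_class: decomposition, multidimensional-sieve, parity-ghost-boundary
- Literature.Barriers.Parity.TargetGraphParity: TwoOfThree is OUTSIDE by construction — the LP ghost
needs k + 2 ≤ 2m and (3,2) violates it (not_hasThresholdGhost_three_two; the sign ghost of
SignGhost.lean is the all-prime case m = k, equally not engaged); PairLift is INSIDE head-on (its
conclusion lives on the ghosted cells (k,k)), declared residual.
- Literature.Barriers.Parity.SelbergParityBarrier: OUTSIDE for TwoOfThree (a ≥2-of-3 existence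
statement obtained by pigeonhole from a weighted count, not a lower bound for a parity-odd set:
Selberg's extremal sets have an LP dual only when k + 2 ≤ 2m); INSIDE head-on for PairLift
(residual).
- Literature.Barriers.Parity.PrimePairParity: OUTSIDE for TwoOfThree (no specified pair is claimed
prime: which two of the three is not controlled — exactly the freedom the barrier does not quantify
over); INSIDE for PairLift (must name the pair with the HL constant), residual.
- Literature.Barriers.Parity.FordMaynardMinimalTypeII: (Ford–Maynard prime-detecting sieves /
minimal Type II) evaded by TwoOfThree via pigeonhole over a tuple (the barrier concerns sieving ONE
sequence for primes with Type I/II information; the Maynard–Tao mechanism never decides which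
coordinate is prime); PairLift inside (residual).
- Literature.Barriers.Parity.MaynardFunctionalCeiling: TwoOfThree as typed REQUIRES going outside
this class — ¬MaynardCriterion θ 3 1 for every θ ≤ 1 (no

History (route lifecycle, newest last):
- 2026-09-04T15:41:08Z · DORMANT — reconciler: no traction for 5 d (last activity statement-checked at 2026-08-30T14:19:05Z); parked, not closed — `ledger route dormant route-Parity-GhostBoundary (operator:999:3244679)

sub-problem: GeneralizedHardyLittlewood · status: dormant · opened planner-decomp-parity-lens-6-g4-0 2026-08-30T06:28:55Z · rev 1 · ledger route-Parity-GhostBoundaryCarving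
GENERATED by the gate from the ledger (D-0016/17). Provers cite these decls: `theorem foo : Summit.Parity.GeneralizedHardyLittlewood.Theses.GhostBoundaryCarving.<Decl> := …` in Summits/Parity/GeneralizedHardyLittlewood/Theorems/<Name>.lean.
-/

namespace Summit.Parity.GeneralizedHardyLittlewood.Theses.GhostBoundaryCarving

open scoped BigOperators Topology Manifold Classical MeasureTheory ProbabilityTheory Matrix InnerProductSpace ComplexConjugate ContinuousMap
open Filter Set Function TopologicalSpace MeasureTheory

attribute [summit_statement] _root_.GeneralizedHardyLittlewood

/-- item stmt-Parity-29350 · crux · rank 2 · open · by planner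
why it might fail: Kernel-implied by GHL and by BH, so false only with Parity; live risk = unprovable by present means: no Maynard criterion reaches (3,2) at any level θ ≤ 1 (not_maynardCriterion_pairs_of_le_one) and level ½ blocks k ≤ 23 even with the ε-trick.
sources: Polymath8b2014, Maynard2015SmallGaps, book:broughannd-bounded-gaps-between-primes, arXiv:1409.8361, Literature.Barriers.Parity.MaynardFunctionalCeiling, Literature.Barriers.Parity.TargetGraphParity
[crux] DHL[3,2]: for every admissible 3-tuple H ⊂ ℤ there are infinitely many n with at least two of
n + h (h ∈ H) prime (Polymath8b Thm 3.2(xii) under GEH; unconditional is OPEN — zone II: needs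
distribution beyond level ½ for ε-enlarged-simplex weights; NOT for provers: GEH-hard, staffable
work = landing the kernel necessity theorem weakDHL_of_fixedLower under Theorems/ and zone-I
instrument rungs DHL[k,2], 24 ≤ k ≤ 49, via MPZ + certified numerics, zero distance credit;
cross-refs: census routes PolymathEpsThreeCeiling, MaynardProductExact; retired TargetGraphParity).
[difficulty: open-problem] -/
@[route_item "route-Parity-GhostBoundaryCarving"]
def TwoOfThree : Prop :=
  Literature.NumberTheory.Sieve.WeakDicksonHardyLittlewood 3 2

/-- item stmt-Parity-29351 · crux · rank 3 · open · by planner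
why it might fail: Kernel-implied by GHL; as an implication it must manufacture prime PAIRS with the HL constant from a ≥2-of-3 existence statement — head-on against PrimePairParity / SelbergParity / FordMaynard (bounded gaps name no pattern).
sources: Polymath8b2014, FordMaynard2024PrimeSieves, Selberg1949, Bombieri1976, Literature.Barriers.Parity.PrimePairParity, Literature.Barriers.Parity.SelbergParity
[crux] DHL[3,2] → FixedLower (the record leaf stmt-Parity-26863, text verbatim): from «two primes
among three shifts infinitely often» to the one-sided Hardy–Littlewood lower bound
archFactor·singularProduct − vonMangoldtSum ≤ εN^d for every fixed non-degenerate system — DECLARED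
RESIDUAL (all parity content; zero credit; never staffed before TwoOfThree). [deps: TwoOfThree]
[difficulty: open-problem] -/
@[route_item "route-Parity-GhostBoundaryCarving"]
def PairLift : Prop :=
  Literature.NumberTheory.Sieve.WeakDicksonHardyLittlewood 3 2 → ∀ (d t : ℕ), 1 ≤ d → 1 ≤ t → ∀ Ψ : Fin t → Literature.NumberTheory.Sieve.AffLinForm d, Literature.NumberTheory.Sieve.IsNondegenerateSystem Ψ → ∀ ε : ℝ, 0 < ε → ∃ N₀ : ℕ, ∀ N : ℕ, N₀ ≤ N → ∀ K : Set (Fin d → ℝ), Convex ℝ K → K ⊆ Literature.NumberTheory.Sieve.realBox d N → Literature.NumberTheory.Sieve.archFactor Ψ K * Literature.NumberTheory.Sieve.singularProduct Ψ - Literature.NumberTheory.Sieve.vonMangoldtSum Ψ K N ≤ ε * (N : ℝ) ^ d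

/-- item stmt-Parity-26864 · crux · rank 4 · open · by planner
why it might fail: It contains binary Goldbach with the Hardy–Littlewood main term for every large even N, given Q and the tuples: no method controls an individual shift h ≍ N; almost-all-h results (MRT 2019, window N^(8/33)) are the ceiling.
sources: GreenTao2010, HardyLittlewood1923, MatomakiRadziwillTao2019, MatomakiMerikoski2023, Literature.Barriers.Parity.CircleMethodBinary
[crux · DECLARED-RESIDUAL; node TupleUniformitySplit (lens-5 g3): shift-uniformity of the lower half
GIVEN bounded Siegel quality and the fixed-pattern lower half] Q → FixedLower → (uniform lower half
of GHL). Exactly the binary content of LQ — binary Goldbach for all large even N with the HL main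
term, and all moving-shift lower bounds — with the tuples split off: kernel
lowerGivenBoundedSiegel_iff : LQ ↔ (Q → FixedLower) ∧ this; WEAKER than LQ (world ¬(Q →
FixedLower)); FixedLower hypothesis load-bearing (T6). INSTRUMENTABLE: kernel
windowLower_of_fixedLower gives all shift windows ≫ εN from FixedLower_{d+1}; this item is
WINDOW(δN) → POINT; notch ladder = rungs (T11). -/
@[route_item "route-Parity-GhostBoundaryCarving"]
def UniformLowerGivenFixed : Prop :=
  (∃ η₀ : ℝ, ∃ q₀ : ℕ, ∀ (q : ℕ) [NeZero q] (χ : DirichletCharacter ℂ q) (η : ℝ), q₀ ≤ q → Literature.Barriers.Parity.IsSiegelZero χ η → η < η₀) → (∀ (d t : ℕ), 1 ≤ d → 1 ≤ t → ∀ Ψ : Fin t → Literature.NumberTheory.Sieve.AffLinForm d, Literature.NumberTheory.Sieve.IsNondegenerateSystem Ψ → ∀ ε : ℝ, 0 < ε → ∃ N₀ : ℕ, ∀ N : ℕ, N₀ ≤ N → ∀ K : Set (Fin d → ℝ), Convex ℝ K → K ⊆ Literature.NumberTheory.Sieve.realBox d N → Literature.NumberTheory.Sieve.archFactor Ψ K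 * Literature.NumberTheory.Sieve.singularProduct Ψ - Literature.NumberTheory.Sieve.vonMangoldtSum Ψ K N ≤ ε * (N : ℝ) ^ d) → ∀ (d t L : ℕ), 1 ≤ d → 1 ≤ t → ∀ ε : ℝ, 0 < ε → ∃ N₀ : ℕ, ∀ N : ℕ, N₀ ≤ N → ∀ Ψ : Fin t → Literature.NumberTheory.Sieve.AffLinForm d, Literature.NumberTheory.Sieve.IsNondegenerateSystem Ψ → Literature.NumberTheory.Sieve.affLinSize Ψ N ≤ L → ∀ K : Set (Fin d → ℝ), Convex ℝ K → K ⊆ Literature.NumberTheory.Sieve.realBox d N → Literature.NumberTheory.Sieve.archFactor Ψ K * Literature.NumberTheory.Sieve.singularProduct Ψ - Literature.NumberTheory.Sieve.vonMangoldtSum Ψ K N ≤ ε * (N : ℝ) ^ d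

/-- item stmt-Parity-26853 · crux · rank 5 · open · by planner
why it might fail: It is the uniform-in-shift (binary Goldbach-type) upper bound with factor 1+ε given Q and all tuples: pointwise-in-h control beyond windows N^(8/33) (MRT 2019) is open; the circle method misses binary minor arcs by log x.
sources: GreenTao2010, MatomakiRadziwillTao2019, MatomakiMerikoski2023, Literature.Barriers.Parity.TrueComplexityBinary, Literature.Barriers.Parity.CircleMethodBinary
[crux · DECLARED-RESIDUAL; node TupleUniformitySplit (lens-5 g3): shift-uniformity of the upper half
GIVEN bounded Siegel quality and the fixed-pattern upper half] Q → FixedUpper → (uniform upper half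
of GHL: one N₀(d,t,L,ε) for all Ψ with ‖Ψ‖_N ≤ L). Exactly the binary / moving-target content of UQ
(Goldbach-type systems (n, N−n), shifts h ≍ N) with the tuple content split off: kernel
upperGivenBoundedSiegel_iff : UQ ↔ (Q → FixedUpper) ∧ this, so WEAKER than UQ (separating world ¬(Q
→ FixedUpper)) and the FixedUpper hypothesis is load-bearing (T6). Transpose of the PairsToGHL cut
(9389: pairs-uniform base, tuples residual). INSTRUMENTABLE: kernel windowUpper_of_fixedUpper —
FixedUpper in dimension d+1 already gives every shift-WINDOW average of length ≫ εN; this item is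
WINDOW(δN) → POINT; notches N^{8/33} (MRT) → N^{7/30} (ShiftTauberian) → polylog are rungs (T11),
not filed. -/
@[route_item "route-Parity-GhostBoundaryCarving"]
def UniformUpperGivenFixed : Prop :=
  (∃ η₀ : ℝ, ∃ q₀ : ℕ, ∀ (q : ℕ) [NeZero q] (χ : DirichletCharacter ℂ q) (η : ℝ), q₀ ≤ q → Literature.Barriers.Parity.IsSiegelZero χ η → η < η₀) → (∀ (d t : ℕ), 1 ≤ d → 1 ≤ t → ∀ Ψ : Fin t → Literature.NumberTheory.Sieve.AffLinForm d, Literature.NumberTheory.Sieve.IsNondegenerateSystem Ψ → ∀ ε : ℝ, 0 < ε → ∃ N₀ : ℕ, ∀ N : ℕ, N₀ ≤ N → ∀ K : Set (Fin d → ℝ), Convex ℝ K → K ⊆ Literature.NumberTheory.Sieve.realBox d N → Literature.NumberTheory.Sieve.vonMangoldtSum Ψ K N - Literature.NumberTheory.Sieve.archFactor Ψ K * Literature.NumberTheory.Sieve.singularProduct Ψ ≤ ε * (N : ℝ) ^ d) → ∀ (d t L : ℕ), 1 ≤ d → 1 ≤ t → ∀ ε : ℝ, 0 < ε → ∃ N₀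 : ℕ, ∀ N : ℕ, N₀ ≤ N → ∀ Ψ : Fin t → Literature.NumberTheory.Sieve.AffLinForm d, Literature.NumberTheory.Sieve.IsNondegenerateSystem Ψ → Literature.NumberTheory.Sieve.affLinSize Ψ N ≤ L → ∀ K : Set (Fin d → ℝ), Convex ℝ K → K ⊆ Literature.NumberTheory.Sieve.realBox d N → Literature.NumberTheory.Sieve.vonMangoldtSum Ψ K N - Literature.NumberTheory.Sieve.archFactor Ψ K * Literature.NumberTheory.Sieve.singularProduct Ψ ≤ ε * (N : ℝ) ^ d

/-- item stmt-Parity-25148 · crux · rank 6 · open · by planner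
why it might fail: it is the Landau–Siegel problem: no unconditional bound on η is known (Siegel's theorem is ineffective); a genuine open problem, not a lemma.
sources: HeathBrown1983PrimeTwins, MatomakiMerikoski2023, TaoTeravainen2021
[crux] Siegel zeros of primitive quadratic characters have bounded quality at all large conductors:
∃ η₀ q₀, every Siegel zero (IsSiegelZero χ η) of conductor q ≥ q₀ has η < η₀ — literally
¬UnboundedSiegelZeros (Landau–Siegel in the form the MM bridge needs). [difficulty: open-problem] ‖
TAG [crit-1 CLEARED 2026-08-30T01:46:27Z, HOME/STATUS.md l.26]: WEAKER (kernel mod MM2023 print; Q ⟹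
GHL unknown); leaf IDEA-NEEDED (Landau–Siegel) + ATTACKABLE-rung (Zhang2022 skeleton routes
PrimeLevelFamEdge/ZDegreeToeplitzBand; lens-2 T_ω ladder) + INSTRUMENTABLE (finite conductor tables,
not a rung). BC3 birth skeleton: stub_weakGoldbach (WeakHLGoldbachConj ½, open) → stub_exclusion
(MM2023 Cor 1.2 Goldbach detector + |L'| ≪ log²q, provable-now) → Q. Census
HOME/census/COSTUME-CENSUS-v1.md sha256
4afbbbc68c038369818dcc2bcc5990569ac50a4757d8938468c0838377ddd628 row WK8. -/
@[route_item "route-Parity-GhostBoundaryCarving"]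
def BoundedSiegelZeroQuality : Prop :=
  ∃ η₀ : ℝ, ∃ q₀ : ℕ, ∀ (q : ℕ) [NeZero q] (χ : DirichletCharacter ℂ q) (η : ℝ), q₀ ≤ q → Literature.Barriers.Parity.IsSiegelZero χ η → η < η₀

/-- item stmt-Parity-26852 · crux · rank 7 · open · by planner
why it might fail: As a target it contains the upper prime k-tuples bound with constant 1+ε for every fixed tuple: Type-I sieves stop at factor 2 (Selberg parity, LinearSieveOptimality); record 3.2996 for twins; open even under GRH.
sources: GreenTao2010, HardyLittlewood1923, Selberg1949, Literature.Barriers.Parity.SelbergParity, Literature.Barriers.Parity.LinearSieveOptimality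
[crux; node TupleUniformitySplit (lens-5 g3, crit-1 CLEARED 2026-08-30T03:41:11Z STATUS l.116),
quantifier-order cut of UQ: the FIXED-PATTERN upper half] For every FIXED non-degenerate
affine-linear system Ψ (all d, t; quantifier order ∀Ψ ∃N₀, no size bound) and ε > 0, eventually in N
and uniformly in convex K ⊆ [−N,N]^d: Σ_{n∈K} ∏Λ(ψ_i(n)) − β_∞(Ψ,K)·∏β_p(Ψ) ≤ εN^d. OPEN CONTENT =
INFINITE complexity only (two affinely dependent forms: the k-tuple translates n+h_1,…,n+h_k and
their fibrations; d = 1 translate face = upper prime k-tuples in Λ-form, all k); finite-complexity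
systems are the Green–Tao–Ziegler THEOREM — the AP face is not progress (critic N2). WEAKER than UQ
and than the uniform upper half (kernel: necessity fixedUpper_of_ghl; Goldbach-vacuity
fixed_holds_goldbachPair — (n, c−n) satisfies it trivially, so no binary content; Siegel-INERT:
fixed-shift HL holds near exceptional scales, MatomakiMerikoski2023_fixedShift / Heath-Brown 1983 /
Tao–Teräväinen, while USZ refutes the uniform half) — hence typed BARE (record T1 logic). Leaf
BARRIER head-on (target constant 1; Type-I sieve ceiling 2 even under EH: SelbergParity,
LinearSieveOptimality); FU is ⊠-closed, so a constan -/
@[route_item "route-Parity-GhostBoundaryCarving"]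
def FixedUpper : Prop :=
  ∀ (d t : ℕ), 1 ≤ d → 1 ≤ t → ∀ Ψ : Fin t → Literature.NumberTheory.Sieve.AffLinForm d, Literature.NumberTheory.Sieve.IsNondegenerateSystem Ψ → ∀ ε : ℝ, 0 < ε → ∃ N₀ : ℕ, ∀ N : ℕ, N₀ ≤ N → ∀ K : Set (Fin d → ℝ), Convex ℝ K → K ⊆ Literature.NumberTheory.Sieve.realBox d N → Literature.NumberTheory.Sieve.vonMangoldtSum Ψ K N - Literature.NumberTheory.Sieve.archFactor Ψ K * Literature.NumberTheory.Sieve.singularProduct Ψ ≤ ε * (N : ℝ) ^ d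

/-- item stmt-Parity-29352 · assembly · rank 1 · closed · proved by Summit.Parity.GeneralizedHardyLittlewood.Theses.GhostBoundaryCarving.assembly_proof (prover) · by planner
sources: GreenTao2010, Polymath8b2014
[assembly] BoundedSiegelZeroQuality → FixedUpper → UniformUpperGivenFixed → TwoOfThree → PairLift →
UniformLowerGivenFixed → GeneralizedHardyLittlewood -/
@[route_item "route-Parity-GhostBoundaryCarving"]
def Assembly : Prop :=
  BoundedSiegelZeroQuality → FixedUpper → UniformUpperGivenFixed → TwoOfThree → PairLift → UniformLowerGivenFixed → GeneralizedHardyLittlewood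

-- `Assembly` holds: proved by `Summit.Parity.GeneralizedHardyLittlewood.Theses.GhostBoundaryCarving.assembly_proof` (its module imports this route file, so no `_holds` link can be stated here).

/-! D-0027 §2.1 — DECIDING THEOREM (planner-authored via `route open/edit --closes-file`; by planner-decomp-parity-lens-6-g4-0 2026-08-30T06:28:55Z):
its hypotheses are this route's items and its conclusion the sub-problem Statement (glue_lint), and it elaborates with this file. -/

@[closes "route-Parity-GhostBoundaryCarving"] theorem closes (hQ : BoundedSiegelZeroQuality) (hFU : FixedUpper) (hUU : UniformUpperGivenFixed)
    (hA : TwoOfThree) (hR : PairLift) (hUL : UniformLowerGivenFixed) : GeneralizedHardyLittlewood := by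
  intro d t L hd ht ε hε
  obtain ⟨N₁, h₁⟩ := hUU hQ hFU d t L hd ht ε hε
  obtain ⟨N₂, h₂⟩ := hUL hQ (hR hA) d t L hd ht ε hε
  refine ⟨max N₁ N₂, fun N hN Ψ hΨ hΨL K hK hKN => abs_sub_le_iff.mpr ⟨?_, ?_⟩⟩
  · exact h₁ N (le_trans (le_max_left _ _) hN) Ψ hΨ hΨL K hK hKN
  · exact h₂ N (le_trans (le_max_right _ _) hN) Ψ hΨ hΨL K hK hKN

end Summit.Parity.GeneralizedHardyLittlewood.Theses.GhostBoundaryCarving
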